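import Summits.ABC.IUTFork.Thm311RealInd1StripTwistJWFirstPlanes
import HarnessLib

/-!
# [IUTchIII] Thm 3.11 (i) (Ind1) at `v ∈ 𝕍^non`, EVEN local degree: print's (Ind1) strip part does NOT preserve the BASE LINE
# `ℚ_p·1 ⊆ K_v` — Kondo's Lemma 2.5 (1) / Hoshi–Nishio's Lemma 2.4 («not (ℚ_{p_k})_+-characteristic») in the kernel, modulo
# `JannsenWingbergTwistsFirst`

PROOF-ONLY file (abc-iut cell, Cor. 3.12 sub-crew, seat abc-iut-c312-1 = holder of record of the typed [IUTchIII] Thm. 3.11,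
gen 12; row «R14 FIRST-PLANE TWIST», part d).  TAKES NO SIDE on [IUTchIII] Cor. 3.12.

Kondo, arXiv:2512.09231, Lemma 2.5: «Suppose that `p_k` is odd, and that `d_k` is even. Let `φ` be the automorphism of `G_k` defined
by … `φ(σ)=σ`, `φ(τ)=τ`, `φ(x_2)=x_2x_1`, `φ(x_i)=x_i` (`i ≠ 2`). Then … (1) For all `n ∈ ℤ ∖ {0}`, it holds that
`φ^n_+(k^{(d=1)}_+) ≠ k^{(d=1)}_+`.»  Hoshi–Nishio, RIMS-1931 Lemma 2.4 (p. 8 l. 22–24): «Suppose that `p_k` is odd, and that `d_k = 2`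
… Then, for every nonzero integer `n`, the automorphism `*α^n` is not `(ℚ_{p_k})_+`-characteristic» (Def. 2.1 (i): `α` is
`(ℚ_{p_k})_+`-characteristic iff `α(k_{(d=1),+}) = k_{(d=1),+}`); Rmk. 2.5: «the submodule `k_{(d=1),+} ⊆ k_+` … should be considered
to be “not group-theoretic”».  HERE, at every finite place `v ∣ p` of a number field with `p` odd and `d = [K_v : ℚ_p] ≥ 2` EVEN,
for the first-pair shear `ψ₀ ∈ Real.ind1StripOf v (Real.galoisLog v)` of `Thm311RealInd1StripTwistJWFirstPlanes` (`ψ₀(x) = x +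
y_2^*(x)·y_1`, Kondo's `φ_+`):
* `Real.coord_one_ne_zero_of_jannsenWingbergFirst` — `y_2^*(1) ≠ 0`: otherwise `1 ∈ ⟨y_1, y_3, …, y_d⟩ = Ker(Tr)` (Kondo Thm. 2.3,
  even case, part c), but `Tr(1) = d ≠ 0`;
* **`Real.apply_algebraMap_not_mem_range_of_jannsenWingbergFirst`** — for every `a ∈ ℚ_p`, `a ≠ 0`: `ψ₀(a·1) ∉ ℚ_p·1`; indeed
  `ψ₀(a) − a = a·y_2^*(1)·y_1` is a NONZERO element of `Ker(Tr)` while `ℚ_p·1 ∩ Ker(Tr) = 0` — THE IMAGE OF THE BASE LINE MEETS THE BASE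
  LINE ONLY IN `0`;
* **`Real.exists_mem_ind1StripOf_not_baseLinePreserving_of_jannsenWingbergFirst`** — the statement of record: some element of print's
  (Ind1) strip part does NOT map `ℚ_p·1 = range(ℚ_p → K_v)` onto itself («not `(ℚ_p)_+`-characteristic»), together with its iterates
  `n • ψ₀`, `n ≠ 0` (Kondo Lemma 2.5 (1); Hoshi–Nishio Lemma 2.4 at `d = 2`).
Reading for the record (neutral, OUR typed objects, one place): Dupuy–Hilado's strip slot is `{1}` and their (Ind2) `Aut_{ℚ_p}(K_v : I_v)`
contains maps moving `ℚ_p·1`, but print's (Ind2) (= `ℤ_p^×` scalars, w5-d216 p452975) FIXES the base line; under PRINT's reading it is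
the (Ind1) STRIP PART that moves the base line `ℚ_p·1 ⊆ K_v` at every even local degree (modulo the named fact) — the log-level form of
Hoshi's «`𝒪^×_{k^{(d=1)}} ⊆ 𝒪_k^×` is not group-theoretic» (Team R row R9f, abc-iut-c312-14 `Thm311RealInd1UnitsBaseLineMover`, whose
inline hypothesis is the unit-level reading at `v₇`).  HONEST SCOPE: conditional on `JannsenWingbergTwistsFirst`; ODD `d` is not treated
here (Kondo Lemma 2.5 is stated for even `d_k`); nothing here asserts or refutes [IUTchIII] Cor. 3.12; NO abc claim.
[claim: Mochizuki2012, status: disputed]; [cite: Kondo2025OuterAutMLF, §2 Lemma 2.5 (1) and Thm 2.3]; [cite: HoshiNishio2022OuterAutMLF,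
Def 2.1 (i), Lemma 2.4, Rmk 2.5 p.8]; [cite: DupuyHilado2025, §4.7, §4.9].  typed ≠ proved; a conditional theorem discharges nothing
it binds.
-/

set_option autoImplicit false

noncomputable section

open Metric Set
open scoped Pointwise

namespace Summit.ABC.IUTFork.Thm311.Real

open NumberField IsDedekindDomain Literature.NumberTheory.NumberFields Literature.IUT.LogVolume
open Literature.NumberTheory.GaloisRepresentations
open Literature.AnabelianGeometry.AbsoluteAnabelian Literature.IUT.HodgeArakelov
open Literature.IUT.HodgeArakelov.AbsTopMonoids

variable {F : Type} [Field F] [NumberField F] (v : HeightOneSpectrum (𝓞 F))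

/-- **`y_2^*(1) ≠ 0`, `ψ₀(a) − a` is a nonzero trace-zero vector, and the base line meets `Ker(Tr)` only in `0`.**  Assume
`JannsenWingbergTwistsFirst`.  At `v ∣ p` odd with `d = [K_v : ℚ_p] ≥ 2` even there are the realised basis `y` (`Fin 2 ⊕ Fin g × Fin 2`)
and the first-pair shear `ψ₀ ∈ Real.ind1StripOf v (Real.galoisLog v)`, `ψ₀(x) = x + y^*_{inl 1}(x)·y_{inl 0}`, of part c, and:
`y^*_{inl 1}(1) ≠ 0` (else `1 ∈ ⟨y_{inl 0}, planes⟩ = Ker(Tr)`, contradicting `Tr 1 = d ≠ 0`), `Tr(y_{inl 0}) = 0`, and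
`ℚ_p·1 ∩ Ker(Tr) = 0`. [claim: Mochizuki2012, status: disputed] [cite: Kondo2025OuterAutMLF, §2 Thm 2.3 and Lemma 2.5] -/
theorem coord_one_ne_zero_of_jannsenWingbergFirst (hJW : JannsenWingbergTwistsFirst)
    (p : ℕ) [Fact p.Prime] (hv : ((p : ℕ) : 𝓞 F) ∈ v.asIdeal) (hp2 : p ≠ 2) (h2 : 2 ≤ localDeg F v) (hev : Even (localDeg F v)) :
    ∃ (g : ℕ) (_ : localDeg F v = 2 + 2 * g) (y : Module.Basis (Fin 2 ⊕ Fin g × Fin 2) ℚ_[p] (RescaledCompletion F p v hv))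
      (ψ₀ : v.adicCompletion F ≃+ v.adicCompletion F),
      ψ₀ ∈ ind1StripOf v (galoisLog v) ∧
      (∀ x : RescaledCompletion F p v hv,
        RescaledCompletion.of F p v hv (ψ₀ ((RescaledCompletion.of F p v hv).symm x)) = x + y.coord (Sum.inl 1) x • y (Sum.inl 0)) ∧
      y.coord (Sum.inl 1) (1 : RescaledCompletion F p v hv) ≠ 0 ∧
      Algebra.trace ℚ_[p] (RescaledCompletion F p v hv) (y (Sum.inl 0)) = 0 ∧
      (∀ a : ℚ_[p], Algebra.trace ℚ_[p] (RescaledCompletion F p v hv) (algebraMap ℚ_[p] (RescaledCompletion F p v hv) a) = 0 →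
        a = 0) := by
  obtain ⟨g, hcard, y, ψ₀, hψ₀, hT₀, hspan, -⟩ := span_eq_ker_trace_of_jannsenWingbergFirst v hJW p hv hp2 h2 hev
  haveI : FiniteDimensional ℚ_[p] (RescaledCompletion F p v hv) := FiniteDimensional.of_locallyCompactSpace ℚ_[p]
  set Tr := Algebra.trace ℚ_[p] (RescaledCompletion F p v hv) with hTr
  have hfin : Module.finrank ℚ_[p] (RescaledCompletion F p v hv) = localDeg F v :=
    (RescaledCompletion.localDeg_eq_finrank F p v hv).symm
  -- `Tr(a·1) = d·a`
  have hTra : ∀ a : ℚ_[p], Tr (algebraMap ℚ_[p] (RescaledCompletion F p v hv) a) = (localDeg F v : ℚ_[p]) * a := by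
    intro a
    rw [hTr, Algebra.trace_algebraMap, hfin, nsmul_eq_mul]
  have hd0 : (localDeg F v : ℚ_[p]) ≠ 0 := by exact_mod_cast (show localDeg F v ≠ 0 by omega)
  have hbase : ∀ a : ℚ_[p], Tr (algebraMap ℚ_[p] (RescaledCompletion F p v hv) a) = 0 → a = 0 := by
    intro a ha
    rw [hTra] at ha
    exact (mul_eq_zero.mp ha).resolve_left hd0
  -- the span `⟨y_{inl 0}, planes⟩` is `y '' {s | s ≠ inl 1}`
  have himage : (y : Fin 2 ⊕ Fin g × Fin 2 → RescaledCompletion F p v hv) '' {s | s ≠ Sum.inl 1} =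
      insert (y (Sum.inl 0)) (Set.range fun iε : Fin g × Fin 2 => y (Sum.inr iε)) := by
    ext z
    simp only [Set.mem_image, Set.mem_setOf_eq, Set.mem_insert_iff, Set.mem_range]
    constructor
    · rintro ⟨s, hs, rfl⟩
      rcases s with t | a
      · fin_cases t
        · exact Or.inl rfl
        · exact absurd rfl hs
      · exact Or.inr ⟨a, rfl⟩
    · rintro (rfl | ⟨a, rfl⟩)
      · exact ⟨Sum.inl 0, by simp, rfl⟩
      · exact ⟨Sum.inr a, by simp, rfl⟩
  -- `Tr(y_{inl 0}) = 0`
  have ht0 : Tr (y (Sum.inl 0)) = 0 := by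
    have h : y (Sum.inl 0) ∈ LinearMap.ker Tr := by
      rw [hTr, ← hspan]; exact Submodule.subset_span (Set.mem_insert _ _)
    exact (LinearMap.mem_ker).mp h
  refine ⟨g, hcard, y, ψ₀, hψ₀, hT₀, fun h0 => ?_, ht0, hbase⟩
  -- if `y^*_{inl 1}(1) = 0` then `1 ∈ span (y '' {s ≠ inl 1}) = Ker Tr`
  have hmem : (1 : RescaledCompletion F p v hv) ∈
      Submodule.span ℚ_[p] ((y : _ → RescaledCompletion F p v hv) '' {s | s ≠ Sum.inl 1}) := by
    rw [Module.Basis.mem_span_image]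
    intro s hs
    simp only [Finset.mem_coe, Finsupp.mem_support_iff] at hs
    intro hs1
    subst hs1
    exact hs h0
  rw [himage, hspan, LinearMap.mem_ker] at hmem
  have h1 : Tr 1 = 0 := hmem
  rw [← map_one (algebraMap ℚ_[p] (RescaledCompletion F p v hv))] at h1
  exact one_ne_zero (hbase 1 h1)

/-- **THE BASE LINE IS MOVED OFF ITSELF**: for the first-pair shear `ψ₀ ∈ Real.ind1StripOf v (Real.galoisLog v)` and every `a ∈ ℚ_p`,
`a ≠ 0`: `ψ₀(a·1) ∉ ℚ_p·1` — the image of the base line `ℚ_p·1 ⊆ K_v` meets the base line only in `0` (`ψ₀(a) − a = a·y_2^*(1)·y_1 ≠ 0`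
lies in `Ker(Tr)`, and `ℚ_p·1 ∩ Ker(Tr) = 0`).  More generally for the iterates: `(n • ψ₀)(a·1) ∉ ℚ_p·1` for `n ≠ 0` (Kondo Lemma 2.5 (1):
«for all `n ∈ ℤ ∖ {0}`, `φ^n_+(k^{(d=1)}_+) ≠ k^{(d=1)}_+`»; the inverses `−n` are the iterates of `ψ₀⁻¹ = x ↦ x − y_2^*(x)·y_1`, not spelled
out). [claim: Mochizuki2012, status: disputed] [cite: Kondo2025OuterAutMLF, §2 Lemma 2.5 (1)] [cite: HoshiNishio2022OuterAutMLF, Lemma 2.4 p.8] -/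
theorem apply_algebraMap_not_mem_range_of_jannsenWingbergFirst (hJW : JannsenWingbergTwistsFirst)
    (p : ℕ) [Fact p.Prime] (hv : ((p : ℕ) : 𝓞 F) ∈ v.asIdeal) (hp2 : p ≠ 2) (h2 : 2 ≤ localDeg F v) (hev : Even (localDeg F v)) :
    ∃ ψ₀ : v.adicCompletion F ≃+ v.adicCompletion F, ψ₀ ∈ ind1StripOf v (galoisLog v) ∧
      ∀ (n : ℕ), n ≠ 0 → ∀ a : ℚ_[p], a ≠ 0 →
        RescaledCompletion.of F p v hv ((n • (ψ₀ : AddAut (v.adicCompletion F)))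
            ((RescaledCompletion.of F p v hv).symm (algebraMap ℚ_[p] (RescaledCompletion F p v hv) a))) ∉
          Set.range (algebraMap ℚ_[p] (RescaledCompletion F p v hv)) := by
  obtain ⟨g, -, y, ψ₀, hψ₀, hT₀, hc, ht0, hbase⟩ := coord_one_ne_zero_of_jannsenWingbergFirst v hJW p hv hp2 h2 hev
  set e := RescaledCompletion.of F p v hv with he
  set Tr := Algebra.trace ℚ_[p] (RescaledCompletion F p v hv) with hTr
  have hcoord : ∀ s t : Fin 2 ⊕ Fin g × Fin 2, y.coord s (y t) = if t = s then 1 else 0 := by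
    intro s t
    rw [Module.Basis.coord_apply, Module.Basis.repr_self, Finsupp.single_apply]
  -- the iterates act as `x ↦ x + n • (y_2^*(x) • y_1)`
  have hpow : ∀ (n : ℕ) (x : RescaledCompletion F p v hv),
      e ((n • (ψ₀ : AddAut (v.adicCompletion F))) (e.symm x)) = x + (n : ℚ_[p]) • (y.coord (Sum.inl 1) x • y (Sum.inl 0)) := by
    intro n
    induction n with
    | zero => intro x; rw [zero_nsmul, Nat.cast_zero, zero_smul, add_zero]; exact e.apply_symm_apply x
    | succ n ih =>
      intro x
      rw [succ_nsmul, AddAut.add_apply, ← e.symm_apply_apply (ψ₀ (e.symm x)), hT₀ x, ih, map_add, map_smul, hcoord,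
        if_neg (by simp), smul_zero, add_zero, Nat.cast_succ, add_smul, one_smul, add_assoc,
        add_comm (y.coord (Sum.inl 1) x • y (Sum.inl 0))]
  refine ⟨ψ₀, hψ₀, fun n hn a ha => ?_⟩
  rintro ⟨b, hb⟩
  rw [hpow] at hb
  -- `y_2^*(a·1) = a · y_2^*(1)`
  have hca : y.coord (Sum.inl 1) (algebraMap ℚ_[p] (RescaledCompletion F p v hv) a) = a * y.coord (Sum.inl 1) 1 := by
    rw [Algebra.algebraMap_eq_smul_one, map_smul, smul_eq_mul]
  rw [hca] at hb
  -- apply `Tr`: `d·b = d·a + 0`, so `b = a`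
  have htr := congrArg Tr hb
  rw [map_add, map_smul, map_smul, ht0, smul_zero, smul_zero, add_zero] at htr
  have hba : b = a := by
    have h := hbase (b - a) (by rw [map_sub, map_sub, htr, sub_self])
    exact sub_eq_zero.mp h
  rw [hba, left_eq_add] at hb
  -- `n • (a y_2^*(1)) • y_1 = 0` forces `y_1 = 0`
  have hy0 : y (Sum.inl 0) ≠ 0 := y.ne_zero _
  rw [smul_smul, smul_eq_zero] at hb
  rcases hb with h | h
  · have hn' : (n : ℚ_[p]) ≠ 0 := by exact_mod_cast hn
    exact (mul_ne_zero hn' (mul_ne_zero ha hc)) h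
  · exact hy0 h

/-- **STATEMENT OF RECORD — print's (Ind1) strip part is NOT base-line-preserving at even local degree** («not `(ℚ_p)_+`-characteristic»,
Hoshi–Nishio Def. 2.1 (i) / Lemma 2.4; Kondo Lemma 2.5 (1)).  Assume `JannsenWingbergTwistsFirst`.  At every finite place `v ∣ p` of a
number field with `p` odd and `[K_v : ℚ_p] ≥ 2` EVEN — in particular at every QUADRATIC `K_v` — some `ψ ∈ Real.ind1StripOf v (Real.galoisLog v)`
does not map the base line `ℚ_p·1 = range(ℚ_p → K_v^{(1/n_v)})` into itself.  Contrast (same place): print's (Ind2) is `ℤ_p^×·id`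
(abc-iut-w5-d216 `ismIsm_analyticLogv_eq_unitScalars`) and fixes it; Dupuy–Hilado's strip slot is `{1}`. [claim: Mochizuki2012, status: disputed]
[cite: HoshiNishio2022OuterAutMLF, Def 2.1 (i), Lemma 2.4, Rmk 2.5 p.8] [cite: Kondo2025OuterAutMLF, §2 Lemma 2.5 (1)] [cite: DupuyHilado2025, §4.7] -/
theorem exists_mem_ind1StripOf_not_baseLinePreserving_of_jannsenWingbergFirst (hJW : JannsenWingbergTwistsFirst)
    (p : ℕ) [Fact p.Prime] (hv : ((p : ℕ) : 𝓞 F) ∈ v.asIdeal) (hp2 : p ≠ 2) (h2 : 2 ≤ localDeg F v) (hev : Even (localDeg F v)) :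
    ∃ ψ : v.adicCompletion F ≃+ v.adicCompletion F, ψ ∈ ind1StripOf v (galoisLog v) ∧
      ¬ Set.MapsTo (fun x => RescaledCompletion.of F p v hv (ψ ((RescaledCompletion.of F p v hv).symm x)))
          (Set.range (algebraMap ℚ_[p] (RescaledCompletion F p v hv)))
          (Set.range (algebraMap ℚ_[p] (RescaledCompletion F p v hv))) := by
  obtain ⟨ψ₀, hψ₀, hmove⟩ := apply_algebraMap_not_mem_range_of_jannsenWingbergFirst v hJW p hv hp2 h2 hev
  refine ⟨ψ₀, hψ₀, fun hmaps => ?_⟩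
  have h := hmove 1 one_ne_zero 1 one_ne_zero
  rw [one_nsmul] at h
  exact h (hmaps ⟨1, rfl⟩)

/-- The same over abc-iut-c312-5's ANALYTIC logarithm `Real.analyticLogv F v` (= the Galois one, w5-d216). [claim: Mochizuki2012, status: disputed]
[cite: HoshiNishio2022OuterAutMLF, Lemma 2.4 p.8] -/
theorem exists_mem_ind1StripOf_analyticLogv_not_baseLinePreserving_of_jannsenWingbergFirst (hJW : JannsenWingbergTwistsFirst)
    (p : ℕ) [Fact p.Prime] (hv : ((p : ℕ) : 𝓞 F) ∈ v.asIdeal) (hp2 : p ≠ 2) (h2 : 2 ≤ localDeg F v) (hev : Even (localDeg F v)) :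
    ∃ ψ : v.adicCompletion F ≃+ v.adicCompletion F, ψ ∈ ind1StripOf v (analyticLogv F v) ∧
      ¬ Set.MapsTo (fun x => RescaledCompletion.of F p v hv (ψ ((RescaledCompletion.of F p v hv).symm x)))
          (Set.range (algebraMap ℚ_[p] (RescaledCompletion F p v hv)))
          (Set.range (algebraMap ℚ_[p] (RescaledCompletion F p v hv))) := by
  rw [← galoisLog_eq_analyticLogv]
  exact exists_mem_ind1StripOf_not_baseLinePreserving_of_jannsenWingbergFirst v hJW p hv hp2 h2 hev

end Summit.ABC.IUTFork.Thm311.Real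

end
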